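import Literature.AlgebraicGeometry.PlaneCurves.HessePencilWeierstrassForm
import HarnessLib

/-!
# The Hessian of a member of the Hesse pencil (Artebani–Dolgachev §2–§3)

Topic `Literature/AlgebraicGeometry/PlaneCurves`, namespace `Literature.AlgebraicGeometry.PlaneCurves`.
Lane `lit-hodgefound`, seat `lit-hodgefound-p37`, row g17-#8; a one-file sequel of
`HessePencilWeierstrassForm` (g16-#4: the flex `(1, −1, 0)` of `H_μ`, its Weierstrass model) and
`HessianFlexCriterion` (Q-row of the lane: Kunz Thm. 9.7 / Cor. 9.6, a smooth point with `2 ≠ 0`,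
`n − 1 ≠ 0` is a flex iff the Hessian determinant vanishes there).  Everything here is PROVED by
direct computation with the tree's `hessianMatrix F = (∂²F/∂Xᵢ∂Xⱼ)`
(`Literature.AlgebraicGeometry.HodgeTheory.hessianMatrix`); no definition, no named fact.

Relation to the seat's Mumford file `RepresentationTheory/HeisenbergGroup/MumfordHeisenbergHessePencilFlexes`
(row Q1531, over `ℂ`, coordinates indexed by `ZMod 3`, its own "third order" flex clause): that
file has, OVER `ℂ`, the evaluated Hessian determinant (`det_hessian_hesseForm`), `nonsingular_iff`,
`singular_of_pow_three_eq_one` and `inflexion_iff_basePoint`; §1 and §3 below are their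
generalisation to an arbitrary field with `3 ≠ 0` (resp. `2, 3 ≠ 0`) in the lane's `Fin 3` /
`hessianMatrix` / `linePoly` vocabulary — so that they compose with `HessianFlexCriterion` and
`HesseCanonicalForm` (every smooth cubic over `K̄` is projectively a smooth `H_μ`) —, while §2 (the
Hessian as a MEMBER OF THE PENCIL, formula (hes)) and §4 (polars, harmonic polars) are new.

Source followed — M. Artebani, I. Dolgachev, *The Hesse pencil of plane cubic curves*,
L'Enseignement Math. (2) 55 (2009) 235–273 [arXiv:math/0611590, held `paper:arxiv-math_0611590`],
§2 (p0004 L3–L4, L10–L17; p0005 L9) and §3 (p0006 L3–L13):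

> Let `k` be an algebraically closed field of characteristic different from `3` and `E` be a
> nonsingular cubic […] The Hessian curve `He(E)` of `E` is the plane cubic curve defined by the
> equation `He(F) = 0`, where `He(F)` is the determinant of the matrix of the second partial
> derivatives of `F`. The nine points in `E ∩ He(E)` are the inflection points of `E`. […]
> The Hesse pencil is the one-dimensional linear system of plane cubic curves given by
> `E_{t₀,t₁} : t₀(x³ + y³ + z³) + t₁xyz = 0` […] Since the pencil is generated by the Fermat cubic
> `E₀` and its Hessian, its nine base points are in the Hesse configuration. In fact, they are the
> inflection points of any smooth curve in the pencil. […] `Δ = […]`, its zeroes describe the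
> singular members of the pencil. […]
> (§3) The first polar of a plane curve `E` with equation `F = 0` with respect to a point
> `q = (a, b, c) ∈ ℙ²` is the curve `P_q(E)` defined by `aF′_x + bF′_y + cF′_z = 0`. […] If `E_λ`
> is a member of the Hesse pencil, we find that `He(E_λ)` is the member `E_{h(λ)}` of the Hesse
> pencil, where `h(λ) = −(108 + λ³)/(3λ²)`. Let `p_i = (a, b, c)` be one of the base points of the
> Hesse pencil. By computing the polar `P_{p_i}(E_λ)` we find that it is equal to the union of the
> inflection tangent line `𝕋_{p_i}(E_λ)` to the curve at the point `p_i` and the line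
> `L_i : ax + by + cz = 0`. The lines `L₀, …, L₈` are called the harmonic polars. It follows
> easily […] that the line `L_i` intersects the curve `E_λ` at 3 points `q_j` such that the
> tangent to the curve at `q_j` contains `p_i`.

## Dictionary

* The pencil member is written `H_μ = X³ + Y³ + Z³ − 3μXYZ` (`λ = −3μ`; local notation `𝐇[μ]`,
  no definition), as in `HessePencilWeierstrassForm` and the Mumford files; §2 also records the
  source's own parametrisation `E_λ = x³ + y³ + z³ + λxyz`.
* `He(F) = (hessianMatrix F).det`; "singular point" = `F(p) = 0 ∧ ∇F(p) = 0`; "flex" = the lane's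
  clause `∀ v, ⟨∇F(p), v⟩ = 0 → LinearIndependent K ![p, v] → X³ ∣ linePoly F p v`; the polar
  `P_q(F) = Σ qᵢ ∂F/∂Xᵢ`, for `q = p₀ = (0, 1, −1)` it is `∂F/∂Y − ∂F/∂Z`; "the tangent at `q`
  contains `p`" = `⟨∇F(q), p⟩ = 0`.

## What is here

* §1 `hesse_eval`, `hesse_eval_pderiv` (`∇H_μ = 3(X² − μYZ, Y² − μXZ, Z² − μXY)`);
  **`hesse_grad_ne_zero`** — for `3 ≠ 0` and `μ³ ≠ 1`, `∇H_μ(p) ≠ 0` at every `p ≠ 0` (the members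
  `μ³ ≠ 1` are SMOOTH; from `X² = μYZ`, … one gets `(XYZ)²(1 − μ³) = 0`); and
  `hesse_singular_of_pow_three_eq_one` — for `μ³ = 1` the point `(1, 1, μ²)` is singular ("its
  zeroes describe the singular members").
* §2 **`hessianMatrix_hesse`**, **`det_hessianMatrix_hesse`**:
  `He(H_μ) = −54μ²(X³ + Y³ + Z³) + (216 − 54μ³)XYZ` — a member of the pencil (any field) —, and
  `det_hessianMatrix_hesse_eq_smul`: `He(H_μ) = (−54μ²) · H_{μ'}`, `μ' = (4 − μ³)/(3μ²)` (`μ ≠ 0`,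
  `3 ≠ 0`); in the source's parametrisation `det_hessianMatrix_hesse'`:
  `He(x³ + y³ + z³ + λxyz) = −6λ²(x³ + y³ + z³) + (216 + 2λ³)xyz` and
  **`det_hessianMatrix_hesse'_eq_smul`: `He(E_λ) = (−6λ²) · E_{h(λ)}`, `h(λ) = −(108 + λ³)/(3λ²)`**
  (`λ ≠ 0`, `3 ≠ 0`) — formula (hes) of §3.
* §3 **"The nine points in `E ∩ He(E)` are the inflection points" / "they are the inflection
  points of any smooth curve in the pencil"**: for `2, 3 ≠ 0` and `μ³ ≠ 1`,
  `hesse_eval_det_hessianMatrix_eq_zero_iff` — a point `p` of `H_μ` lies on `He(H_μ)` iff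
  `p₀p₁p₂ = 0 ∧ p₀³ + p₁³ + p₂³ = 0` (the base locus of the pencil; `He(H_μ)(p) = 216(1 − μ³)p₀p₁p₂`
  on the curve), and **`hesse_flex_iff`** — `p ≠ 0` on `H_μ` is a flex iff `p₀p₁p₂ = 0`
  (via `HessianFlexCriterion.eval_det_hessianMatrix_eq_zero_iff` and §1).
* §4 **The polar of a base point**: `hesse_polar_basePoint` —
  `∂H_μ/∂Y − ∂H_μ/∂Z = 3(Y − Z)(Y + Z + μX)`: the polar of `p₀ = (0, 1, −1)` is the harmonic polar
  `L₀ : Y − Z = 0` times the inflection tangent `μX + Y + Z = 0` at `p₀` (`hesse_basePoint`: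
  `H_μ(p₀) = 0`, `∇H_μ(p₀) = (3μ, 3, 3)`); `hesse_tangent_through_basePoint` — the tangent at every
  point of `H_μ ∩ L₀` contains `p₀`; `hesse_eval_harmonicPolar` — `H_μ(x, y, y) = x³ + 2y³ − 3μxy²`
  (the three points `q_j`; the source's `1 + 2y³ + λy²` at `x = 1`).

Hypotheses, compared with the source: Artebani–Dolgachev have `k = k̄` of characteristic `≠ 3`;
here the identities of §2 and §4 hold over every field, smoothness needs `3 ≠ 0`, and §3 needs
`2 ≠ 0` and `3 ≠ 0` (the flex criterion).  NOT here: the explicit list of the nine base points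
with a cube root of unity `ε` and the four singular triangles (the Mumford file
`MumfordHeisenbergHessePencilFlexes`, Q1531, has the nine flexes over `ℂ`), "He(E) = locus of
reducible polar conics", Prop. 3.2, the `2`-torsion statement, the Cayleyan.

## References
* [ArtebaniDolgachev2009] M. Artebani, I. Dolgachev, *The Hesse pencil of plane cubic curves*,
  Enseign. Math. (2) 55 (2009) 235–273, §2 and §3 (formula (hes), the harmonic polars).
* [Kunz2005PlaneAlgebraicCurves] E. Kunz, *Introduction to Plane Algebraic Curves*, Birkhäuser
  2005, Ch. 9, Def. 9.1 (polars), Thm. 9.7 (Hessian and flexes).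
* [Mumford1966EquationsI] D. Mumford, *On the equations defining abelian varieties I*, Invent.
  Math. 1 (1966), §5 Case b) (the cubics `X³ + Y³ + Z³ − 3μXYZ`, non-singular for `μ ≠ 1, ω, ω², ∞`).
-/

set_option autoImplicit false

open MvPolynomial Matrix
open Literature.AlgebraicGeometry.HodgeTheory (hessianMatrix hessianMatrix_apply)
open Literature.AlgebraicGeometry.HyperbolicPolynomials

namespace Literature.AlgebraicGeometry.PlaneCurves

universe u

/-- The Hesse cubic `H_μ = X³ + Y³ + Z³ − 3μXYZ` (local notation as in the statements of
`HessePencilWeierstrassForm`, no definition). -/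
local notation3 "𝐇[" μ "]" =>
  (X 0 ^ 3 + X 1 ^ 3 + X 2 ^ 3 - C (3 * μ) * (X 0 * X 1 * X 2) : MvPolynomial (Fin 3) _)

section HesseHessian

variable {K : Type u} [Field K]

/-- Derivations kill numerals (`no_index` so that `simp` matches literals). [folklore] -/
private theorem pderiv_ofNat' (i : Fin 3) (n : ℕ) [n.AtLeastTwo] :
    pderiv i (no_index (OfNat.ofNat n : MvPolynomial (Fin 3) K)) = 0 := by
  rw [← map_ofNat (C : K →+* MvPolynomial (Fin 3) K) n, pderiv_C]

/-- The partial derivatives of `H_μ`. [folklore] -/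
private theorem pderiv_hesse (μ : K) :
    (pderiv 0 𝐇[μ] = C 3 * X 0 ^ 2 - C (3 * μ) * (X 1 * X 2)) ∧
    (pderiv 1 𝐇[μ] = C 3 * X 1 ^ 2 - C (3 * μ) * (X 0 * X 2)) ∧
    (pderiv 2 𝐇[μ] = C 3 * X 2 ^ 2 - C (3 * μ) * (X 0 * X 1)) := by
  refine ⟨?_, ?_, ?_⟩ <;> simp [pderiv_X, pderiv_ofNat', map_ofNat, mul_comm]

/-! ## §1 The gradient; smooth members -/

/-- `H_μ(p) = p₀³ + p₁³ + p₂³ − 3μ p₀p₁p₂`. [cite: ArtebaniDolgachev2009, §2 (the Hesse pencil)] -/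
theorem hesse_eval (μ : K) (p : Fin 3 → K) :
    eval p 𝐇[μ] = p 0 ^ 3 + p 1 ^ 3 + p 2 ^ 3 - 3 * μ * (p 0 * p 1 * p 2) := by
  simp

/-- **The gradient of `H_μ`**: `∇H_μ(p) = (3p₀² − 3μp₁p₂, 3p₁² − 3μp₀p₂, 3p₂² − 3μp₀p₁)`.
[cite: ArtebaniDolgachev2009, §3 (the first polars `aF′_x + bF′_y + cF′_z`)] -/
theorem hesse_eval_pderiv (μ : K) (p : Fin 3 → K) :
    (fun i => eval p (pderiv i 𝐇[μ])) =
      ![3 * p 0 ^ 2 - 3 * μ * (p 1 * p 2), 3 * p 1 ^ 2 - 3 * μ * (p 0 * p 2),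
        3 * p 2 ^ 2 - 3 * μ * (p 0 * p 1)] := by
  obtain ⟨d0, d1, d2⟩ := pderiv_hesse μ
  funext i
  fin_cases i
  · show eval p (pderiv 0 𝐇[μ]) = 3 * p 0 ^ 2 - 3 * μ * (p 1 * p 2)
    rw [d0]; simp [map_ofNat]
  · show eval p (pderiv 1 𝐇[μ]) = 3 * p 1 ^ 2 - 3 * μ * (p 0 * p 2)
    rw [d1]; simp [map_ofNat]
  · show eval p (pderiv 2 𝐇[μ]) = 3 * p 2 ^ 2 - 3 * μ * (p 0 * p 1)
    rw [d2]; simp [map_ofNat]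

/-- **The members `μ³ ≠ 1` are smooth** ("its zeroes describe the singular members of the pencil"):
over a field with `3 ≠ 0`, if `μ³ ≠ 1` then `∇H_μ(p) ≠ 0` for every `p ≠ 0` — from
`p₀² = μp₁p₂`, `p₁² = μp₀p₂`, `p₂² = μp₀p₁` one gets `(p₀p₁p₂)²(1 − μ³) = 0`, then `p = 0`
(over `ℂ`: Q1531 `MumfordHeisenbergHessePencilFlexes.eq_zero_of_pderiv_hesseForm_eq_zero`).
[cite: ArtebaniDolgachev2009, §2 (the discriminant of the Hesse pencil)]
[cite: Mumford1966EquationsI, §5 Case b) ("non-singular for `μ ≠ 1, ω, ω², ∞`")] -/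
theorem hesse_grad_ne_zero (h3 : (3 : K) ≠ 0) {μ : K} (hμ : μ ^ 3 ≠ 1) {p : Fin 3 → K}
    (hp0 : p ≠ 0) : (fun i => eval p (pderiv i 𝐇[μ])) ≠ 0 := by
  rw [hesse_eval_pderiv]
  intro h
  have e0 : p 0 ^ 2 = μ * (p 1 * p 2) := by
    have := congr_fun h 0
    simp only [Matrix.cons_val_zero, Pi.zero_apply] at this
    exact (mul_right_inj' h3).1 (by linear_combination this)
  have e1 : p 1 ^ 2 = μ * (p 0 * p 2) := by
    have := congr_fun h 1
    simp only [Matrix.cons_val_one, Matrix.cons_val_zero, Pi.zero_apply] at this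
    exact (mul_right_inj' h3).1 (by linear_combination this)
  have e2 : p 2 ^ 2 = μ * (p 0 * p 1) := by
    have := congr_fun h 2
    simp only [Matrix.cons_val, Pi.zero_apply] at this
    exact (mul_right_inj' h3).1 (by linear_combination this)
  -- `(p₀p₁p₂)² (1 − μ³) = 0`, so `p₀p₁p₂ = 0`
  have hπ : (p 0 * p 1 * p 2) ^ 2 * (1 - μ ^ 3) = 0 := by
    linear_combination (p 1 ^ 2 * p 2 ^ 2) * e0 + (μ * p 1 * p 2 ^ 3) * e1 +
      (μ ^ 2 * p 0 * p 1 * p 2 ^ 2) * e2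
  have hπ' : p 0 * p 1 * p 2 = 0 := by
    rcases mul_eq_zero.1 hπ with h' | h'
    · exact (pow_eq_zero_iff two_ne_zero).1 h'
    · exact absurd (by linear_combination -h') hμ
  apply hp0
  rcases mul_eq_zero.1 hπ' with h01 | h2'
  · rcases mul_eq_zero.1 h01 with h0' | h1'
    · have h1' : p 1 = 0 := (pow_eq_zero_iff two_ne_zero).1 (by rw [e1, h0']; ring)
      have h2' : p 2 = 0 := (pow_eq_zero_iff two_ne_zero).1 (by rw [e2, h0']; ring)
      funext i; fin_cases i <;> assumption
    · have h0' : p 0 = 0 := (pow_eq_zero_iff two_ne_zero).1 (by rw [e0, h1']; ring)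
      have h2' : p 2 = 0 := (pow_eq_zero_iff two_ne_zero).1 (by rw [e2, h1']; ring)
      funext i; fin_cases i <;> assumption
  · have h0' : p 0 = 0 := (pow_eq_zero_iff two_ne_zero).1 (by rw [e0, h2']; ring)
    have h1' : p 1 = 0 := (pow_eq_zero_iff two_ne_zero).1 (by rw [e1, h2']; ring)
    funext i; fin_cases i <;> assumption

/-- **The members `μ³ = 1` are singular**: if `μ³ = 1`, the point `(1, 1, μ²)` lies on `H_μ` and
`∇H_μ` vanishes there (over any field; over `ℂ`: Q1531 `…HessePencilFlexes.singular_of_pow_three_eq_one`).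
[cite: ArtebaniDolgachev2009, §2 ("its zeroes describe the singular members of the pencil"; the
four singular members `E_∞, E_{−3}, E_{−3ε}, E_{−3ε²}`)] -/
theorem hesse_singular_of_pow_three_eq_one {μ : K} (hμ : μ ^ 3 = 1) :
    eval ![1, 1, μ ^ 2] 𝐇[μ] = 0 ∧ (fun i => eval ![1, 1, μ ^ 2] (pderiv i 𝐇[μ])) = 0 := by
  rw [hesse_eval, hesse_eval_pderiv]
  constructor
  · simp
    linear_combination (μ ^ 3 - 2) * hμ
  · funext i
    fin_cases i
    · simp; linear_combination -(3 : K) * hμ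
    · simp; linear_combination -(3 : K) * hμ
    · simp; linear_combination (3 * μ) * hμ

/-! ## §2 The Hessian of `H_μ` lies in the pencil -/

/-- **The Hessian matrix of `H_μ`**: `(∂²H_μ/∂Xᵢ∂Xⱼ) = [[6X, −3μZ, −3μY], [−3μZ, 6Y, −3μX],
[−3μY, −3μX, 6Z]]`. [cite: ArtebaniDolgachev2009, §2 ("`He(F)` is the determinant of the matrix of
the second partial derivatives of `F`")] -/
theorem hessianMatrix_hesse (μ : K) :
    hessianMatrix 𝐇[μ] =
      Matrix.of ![![C 6 * X 0, -(C (3 * μ) * X 2), -(C (3 * μ) * X 1)],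
        ![-(C (3 * μ) * X 2), C 6 * X 1, -(C (3 * μ) * X 0)],
        ![-(C (3 * μ) * X 1), -(C (3 * μ) * X 0), C 6 * X 2]] := by
  ext i j : 1
  rw [hessianMatrix_apply]
  fin_cases i <;> fin_cases j <;> simp [pderiv_X, pderiv_ofNat', map_ofNat] <;> ring

/-- **The Hessian of a member of the Hesse pencil is a member of the pencil** (any field):
`He(H_μ) = det(∂²H_μ) = −54μ² (X³ + Y³ + Z³) + (216 − 54μ³) XYZ`.
[cite: ArtebaniDolgachev2009, §3, formula for `He(E_λ)`] -/
theorem det_hessianMatrix_hesse (μ : K) :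
    (hessianMatrix 𝐇[μ]).det =
      C (-(54 * μ ^ 2)) * (X 0 ^ 3 + X 1 ^ 3 + X 2 ^ 3) + C (216 - 54 * μ ^ 3) * (X 0 * X 1 * X 2) := by
  rw [hessianMatrix_hesse, Matrix.det_fin_three]
  simp [map_neg, map_sub, map_mul, map_pow, map_ofNat]
  ring

/-- `He(H_μ) = (−54μ²) · H_{μ'}` with `μ' = (4 − μ³)/(3μ²)`, for `μ ≠ 0` and `3 ≠ 0` — the
source's `h(λ) = −(108 + λ³)/(3λ²)` in the parametrisation `λ = −3μ`.
[cite: ArtebaniDolgachev2009, §3, `He(E_λ) = E_{h(λ)}`] -/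
theorem det_hessianMatrix_hesse_eq_smul (h3 : (3 : K) ≠ 0) {μ : K} (hμ : μ ≠ 0) :
    (hessianMatrix 𝐇[μ]).det = (-(54 * μ ^ 2)) • 𝐇[(4 - μ ^ 3) / (3 * μ ^ 2)] := by
  rw [det_hessianMatrix_hesse, smul_eq_C_mul]
  have e : (3 : K) * ((4 - μ ^ 3) / (3 * μ ^ 2)) = (4 - μ ^ 3) / μ ^ 2 := by
    field_simp
  rw [e]
  have e' : (C (216 - 54 * μ ^ 3) : MvPolynomial (Fin 3) K) =
      C (-(54 * μ ^ 2)) * -C ((4 - μ ^ 3) / μ ^ 2) := by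
    rw [← C_neg, ← C_mul]; congr 1; field_simp; ring
  rw [e']
  ring

/-- The source's parametrisation `E_λ = x³ + y³ + z³ + λxyz` (any field):
`He(E_λ) = −6λ² (x³ + y³ + z³) + (216 + 2λ³) xyz`.
[cite: ArtebaniDolgachev2009, §3, `He(E_λ) = E_{h(λ)}`] -/
theorem det_hessianMatrix_hesse' (la : K) :
    (hessianMatrix (X 0 ^ 3 + X 1 ^ 3 + X 2 ^ 3 + C la * (X 0 * X 1 * X 2) :
        MvPolynomial (Fin 3) K)).det =
      C (-(6 * la ^ 2)) * (X 0 ^ 3 + X 1 ^ 3 + X 2 ^ 3) + C (216 + 2 * la ^ 3) * (X 0 * X 1 * X 2) := by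
  have hH : hessianMatrix (X 0 ^ 3 + X 1 ^ 3 + X 2 ^ 3 + C la * (X 0 * X 1 * X 2) :
      MvPolynomial (Fin 3) K) =
      Matrix.of ![![C 6 * X 0, C la * X 2, C la * X 1],
        ![C la * X 2, C 6 * X 1, C la * X 0],
        ![C la * X 1, C la * X 0, C 6 * X 2]] := by
    ext i j : 1
    rw [hessianMatrix_apply]
    fin_cases i <;> fin_cases j <;> simp [pderiv_X, pderiv_ofNat', map_ofNat] <;> ring
  rw [hH, Matrix.det_fin_three]
  simp [map_neg, map_add, map_mul, map_pow, map_ofNat]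
  ring

/-- **"If `E_λ` is a member of the Hesse pencil, we find that `He(E_λ)` is the member `E_{h(λ)}`
of the Hesse pencil, where `h(λ) = −(108 + λ³)/(3λ²)`"** — precisely
`He(E_λ) = (−6λ²) · (x³ + y³ + z³ + h(λ) xyz)` for `λ ≠ 0`, `3 ≠ 0`.
[cite: ArtebaniDolgachev2009, §3, formula (hes)] -/
theorem det_hessianMatrix_hesse'_eq_smul (h3 : (3 : K) ≠ 0) {la : K} (hla : la ≠ 0) :
    (hessianMatrix (X 0 ^ 3 + X 1 ^ 3 + X 2 ^ 3 + C la * (X 0 * X 1 * X 2) :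
        MvPolynomial (Fin 3) K)).det =
      (-(6 * la ^ 2)) • (X 0 ^ 3 + X 1 ^ 3 + X 2 ^ 3 + C (-(108 + la ^ 3) / (3 * la ^ 2)) *
        (X 0 * X 1 * X 2) : MvPolynomial (Fin 3) K) := by
  rw [det_hessianMatrix_hesse', smul_eq_C_mul]
  have e' : (C (216 + 2 * la ^ 3) : MvPolynomial (Fin 3) K) =
      C (-(6 * la ^ 2)) * C (-(108 + la ^ 3) / (3 * la ^ 2)) := by
    rw [← C_mul]; congr 1; field_simp; ring
  rw [e']
  ring

/-! ## §3 The nine points of `E ∩ He(E)` are the base points of the pencil -/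

/-- **"The nine points in `E ∩ He(E)`" are the base points of the pencil**: for `2, 3 ≠ 0` and a
smooth member `μ³ ≠ 1`, a point `p` of `H_μ` lies on the Hessian curve `He(H_μ) = 0` iff
`p₀p₁p₂ = 0` and `p₀³ + p₁³ + p₂³ = 0`, i.e. iff `p` is a base point of the pencil `{XYZ = 0} ∩
{X³ + Y³ + Z³ = 0}` (on the curve, `He(H_μ)(p) = 216(1 − μ³)·p₀p₁p₂`; over `ℂ`: Q1531
`…HessePencilFlexes.det_hessian_hesseForm_of_eval_eq_zero`).
[cite: ArtebaniDolgachev2009, §2 ("Since the pencil is generated by the Fermat cubic `E₀` and its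
Hessian, its nine base points are … the inflection points of any smooth curve in the pencil")] -/
theorem hesse_eval_det_hessianMatrix_eq_zero_iff (h2 : (2 : K) ≠ 0) (h3 : (3 : K) ≠ 0) {μ : K}
    (hμ : μ ^ 3 ≠ 1) {p : Fin 3 → K} (hp : eval p 𝐇[μ] = 0) :
    eval p (hessianMatrix 𝐇[μ]).det = 0 ↔ p 0 * p 1 * p 2 = 0 ∧ p 0 ^ 3 + p 1 ^ 3 + p 2 ^ 3 = 0 := by
  rw [hesse_eval] at hp
  rw [det_hessianMatrix_hesse]
  simp only [map_add, map_mul, eval_C, map_pow, eval_X]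
  have h216 : (216 : K) * (1 - μ ^ 3) ≠ 0 := by
    refine mul_ne_zero ?_ (sub_ne_zero.2 (Ne.symm hμ))
    rw [show (216 : K) = 2 ^ 3 * 3 ^ 3 by norm_num]
    exact mul_ne_zero (pow_ne_zero 3 h2) (pow_ne_zero 3 h3)
  constructor
  · intro h
    have hπ : 216 * (1 - μ ^ 3) * (p 0 * p 1 * p 2) = 0 := by
      linear_combination h + 54 * μ ^ 2 * hp
    have hπ' := (mul_eq_zero.1 hπ).resolve_left h216
    exact ⟨hπ', by linear_combination hp + 3 * μ * hπ'⟩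
  · rintro ⟨hπ, hS⟩
    rw [hπ, hS]; ring

/-- **"they are the inflection points of any smooth curve in the pencil"**: over a field with
`2 ≠ 0` and `3 ≠ 0`, for a smooth member `H_μ` (`μ³ ≠ 1`) and a point `p ≠ 0` of it, `p` is a flex
(every tangent line meets `H_μ` with multiplicity `≥ 3` at `p`) iff `p₀p₁p₂ = 0` — the Hessian
criterion (`HessianFlexCriterion.eval_det_hessianMatrix_eq_zero_iff`, Kunz Thm. 9.7) at a smooth
point (`hesse_grad_ne_zero`) combined with `hesse_eval_det_hessianMatrix_eq_zero_iff` (over `ℂ`,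
with Mumford's "third order" clause: Q1531 `…HessePencilFlexes.inflexion_iff_basePoint`).
[cite: ArtebaniDolgachev2009, §2 ("The nine points in `E ∩ He(E)` are the inflection points of
`E`")] [cite: Kunz2005PlaneAlgebraicCurves, Ch. 9, Thm. 9.7]
[cite: Mumford1966EquationsI, §5 Case b)] -/
theorem hesse_flex_iff (h2 : (2 : K) ≠ 0) (h3 : (3 : K) ≠ 0) {μ : K} (hμ : μ ^ 3 ≠ 1)
    {p : Fin 3 → K} (hp0 : p ≠ 0) (hp : eval p 𝐇[μ] = 0) :
    (∀ v, (fun i => eval p (pderiv i 𝐇[μ])) ⬝ᵥ v = 0 → LinearIndependent K ![p, v] →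
        Polynomial.X ^ 3 ∣ linePoly 𝐇[μ] p v) ↔ p 0 * p 1 * p 2 = 0 := by
  have hF : (𝐇[μ] : MvPolynomial (Fin 3) K).IsHomogeneous 3 := by
    refine ((((isHomogeneous_X K 0).pow 3).add ((isHomogeneous_X K 1).pow 3)).add
      ((isHomogeneous_X K 2).pow 3)).sub ?_
    have h := ((isHomogeneous_C (Fin 3) (3 * μ)).mul
      (((isHomogeneous_X K 0).mul (isHomogeneous_X K 1)).mul (isHomogeneous_X K 2)))
    simpa using h
  have hgrad := hesse_grad_ne_zero h3 hμ hp0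
  have key := eval_det_hessianMatrix_eq_zero_iff (n := 3) h2 (by norm_num; exact h2) hF hp0 hp
  rw [hesse_eval_det_hessianMatrix_eq_zero_iff h2 h3 hμ hp] at key
  constructor
  · intro hflex
    exact (key.2 (Or.inr ⟨hgrad, hflex⟩)).1
  · intro hπ
    have hS : p 0 ^ 3 + p 1 ^ 3 + p 2 ^ 3 = 0 := by
      rw [hesse_eval] at hp; linear_combination hp + 3 * μ * hπ
    rcases key.1 ⟨hπ, hS⟩ with h | h
    · exact absurd h hgrad
    · exact h.2

/-! ## §4 The polar of a base point: inflection tangent and harmonic polar -/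

/-- **"the polar `P_{p_i}(E_λ)` … is equal to the union of the inflection tangent line
`𝕋_{p_i}(E_λ)` … and the line `L_i : ax + by + cz = 0`"**, for the base point `p₀ = (0, 1, −1)`
(any field): `P_{p₀}(H_μ) = ∂H_μ/∂Y − ∂H_μ/∂Z = 3 (Y − Z)(Y + Z + μX)` — the harmonic polar
`L₀ : Y − Z = 0` times the inflection tangent `μX + Y + Z = 0` at `p₀` (`hesse_basePoint`).
[cite: ArtebaniDolgachev2009, §3 (the harmonic polars)] -/
theorem hesse_polar_basePoint (μ : K) :
    pderiv 1 𝐇[μ] - pderiv 2 𝐇[μ] = C 3 * (X 1 - X 2) * (X 1 + X 2 + C μ * X 0) := by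
  obtain ⟨-, d1, d2⟩ := pderiv_hesse μ
  rw [d1, d2, map_mul]
  ring

/-- The base point `p₀ = (0, 1, −1)` lies on every `H_μ`, with `∇H_μ(p₀) = (3μ, 3, 3)`: its tangent
line is `μX + Y + Z = 0` (when `3 ≠ 0`). [cite: ArtebaniDolgachev2009, §2 (`p₀ = (0, 1, −1)`), §3] -/
theorem hesse_basePoint (μ : K) :
    eval ![0, 1, -1] 𝐇[μ] = 0 ∧ (fun i => eval ![0, 1, -1] (pderiv i 𝐇[μ])) = ![3 * μ, 3, 3] := by
  rw [hesse_eval, hesse_eval_pderiv]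
  constructor
  · simp; norm_num
  · funext i; fin_cases i <;> simp

/-- **"the line `L_i` intersects the curve `E_λ` at 3 points `q_j` such that the tangent to the
curve at `q_j` contains `p_i`"** (`i = 0`, any field): for every `q` on the harmonic polar
`L₀ : Y = Z`, `⟨∇H_μ(q), p₀⟩ = 0` with `p₀ = (0, 1, −1)` — the tangent at `q` passes through `p₀`.
[cite: ArtebaniDolgachev2009, §3 (the harmonic polars)] -/
theorem hesse_tangent_through_basePoint (μ : K) {q : Fin 3 → K} (hq : q 1 = q 2) :
    (fun i => eval q (pderiv i 𝐇[μ])) ⬝ᵥ ![0, 1, -1] = 0 := by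
  rw [hesse_eval_pderiv]
  simp [dotProduct, Fin.sum_univ_three]
  rw [hq]; ring

/-- The three points `q_j`: on the harmonic polar `L₀ = {(x, y, y)}` the cubic restricts to
`H_μ(x, y, y) = x³ + 2y³ − 3μxy²` (the source's `1 + 2y_j³ + λy_j²` at `x = 1`, `λ = −3μ`).
[cite: ArtebaniDolgachev2009, §3, proof of Prop. 3.2] -/
theorem hesse_eval_harmonicPolar (μ x y : K) :
    eval ![x, y, y] 𝐇[μ] = x ^ 3 + 2 * y ^ 3 - 3 * μ * x * y ^ 2 := by
  rw [hesse_eval]; simp; ring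

end HesseHessian

end Literature.AlgebraicGeometry.PlaneCurves
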